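import Summits.BirchSwinnertonDyer.BirchSwinnertonDyer.Theorems.ResidualThetaTransportAtTwoThetaLayerLambdaCongruenceAtTwoLayerModulus
import Literature.NumberTheory.EllipticCurves.MazurTateElementCoeffField
import Literature.NumberTheory.EllipticCurves.PAdicLFunctionIntegralityAtTwoProofs
import Literature.NumberTheory.EllipticCurves.SharpFlatPAdicLFunctionCoeffField
import Literature.NumberTheory.EllipticCurves.NewformsCoeffFieldHolds
import Literature.NumberTheory.EllipticCurves.GreenbergVatsal2000.NonPrimitivePAdicLFunction
import Literature.NumberTheory.IwasawaTheory.LayerIwasawaInvariants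
import HarnessLib

/-!
# Crux `ThetaLayerLambdaCongruenceAtTwo` (stmt-BirchSwinnertonDyer-20688, route ResidualThetaTransportAtTwo), line
# `birth`: the `Δ = {±1}` DOUBLING of the tree's Mazur–Tate elements at `p = 2`, and what it does to the stubs
# (H)/(μ) of skeleton v3 (width prover bsd-wall-rtt-p3-w2 g0; `--supports stmt-BirchSwinnertonDyer-20688`; closes
# nothing)

HONEST FRAMING. THEOREMS of the tree's definitions only; nothing about any curve or form is asserted; BSD is not
proved by any of this.

WHAT. The tree's Mazur–Tate element of a newform `g` with Hecke field `K_g` relative to a period `Ω`,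
`mazurTateElementK g Ω p n = ∑_{ξ ∈ μ_{torsionOrder p}(ℤ_p)} ∑_{s mod pⁿ} [ξγ^s/p^{n+e₀}]⁺_{g,Ω} (1+X)^s`
(`MazurTateElementCoeffField.lean`, Pollack–Weston (2.1) with the Teichmüller parametrisation of the tree's
`mazurTateElement`), sums at `p = 2` over `ξ ∈ {±1}` (`torsionOrder 2 = 2`, `γ = 5`, level `2^{n+2}`). Since the
plus symbol is EVEN and `1`-PERIODIC (`plusSymbol_neg`, `modularSymbol_add_intCast_holds`), the `ξ = −1` half equals
the `ξ = 1` half (§1–§2):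

  `θ_n(g;Ω) = mazurTateElementK g Ω 2 n = C 2 · ∑_{s mod 2ⁿ} [5^s/2^{n+2}]⁺_{g,Ω} (1+X)^s`

— the `K_g`-valued twin of the Δ-doubling `padicLRiemannSum_two` already proved for the rational Riemann sums
(`PAdicLFunctionIntegralityAtTwoProofs.lean` §3). CONSEQUENCES (§3–§4): at a COHOMOLOGICAL plus period `Ω` along
`ι : K_g → ℚ̄₂` (Pollack–Weston Def. 2.1: all `ι[r]⁺` integral) every coefficient of `(θ_n(g;Ω)).map ι` has norm
`≤ ‖2‖₂ = 1/2`, so `‖(θ_n(g;Ω)).map ι‖_sup ≤ 1/2 < 1` for EVERY `n` (PW Rem. 2.2 holds with slack in the tree's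
normalisation at `2`); the partner's `S₀`-depletion Euler factors of the crux are `ι`-integral (newform coefficients
are algebraic integers, `IsNewform0.isIntegral_coeff_holds`; `ℓ_v` odd for `v ∈ S₀` as `2 ∉ v`), reduction modulo the
integral monic `ω_n = (X+1)^{2ⁿ} − 1` does not increase the sup norm (landed `supNorm_modByMonic_le`), hence the
partner's depleted layer element `Θ^{S₀}_n(g;Ω)` of the crux satisfies `‖Θ^{S₀}_n(g;Ω)‖_sup ≤ 1/2` at every layer.
THEREFORE (§5): the registered stub (μ) `stub_depletedLayerMuCoh` of skeleton v3 (sha16 e73fe75e5ab62447), whose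
conclusion is `‖Θ^{S₀}_n(g;Ω)‖_sup = 1` for all large even `n` at a cohomological `Ω`, has a conclusion that is FALSE
for every instance of its binders (`not_stubMu_conclusion`) — it is MIS-STATED (it can only hold vacuously), and the
registered stub (H) `stub_depletedLayerCongruenceCoh` (`∃ a, ‖C a·Θ_W − Θ_g‖_sup < 1`) holds TRIVIALLY with `a = 0`
(`stubH_conclusion_trivial`). The crux itself is untouched (`λ` is scale-invariant); the repair is to state the
congruence RELATIVELY (`‖C a·Θ_W − Θ_g‖_sup < ‖Θ_g‖_sup`) or with the bound `‖2‖` in place of `1` — see the companion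
glue file `…ThetaLayerLambdaCongruenceAtTwoRelReduction.lean`.

References: [PollackWeston2011MT] §2.1 (2.1), Def. 2.1, Rem. 2.2, §3.1; [MazurTateTeitelbaum1986Invent] §I.8
(`[−r]⁺ = [r]⁺`), §I.13 (`p = 2`: `Δ = {±1}`, `γ = 5`); [Shimura1971] Thm. 3.48 (integrality of newform
coefficients).
-/

noncomputable section

-- justification: the `Summit.BirchSwinnertonDyer.BirchSwinnertonDyer.…` path repeats a component (route-file convention)
set_option linter.dupNamespace false

open scoped Classical

open Polynomial

open Literature.NumberTheory.IwasawaTheory Literature.NumberTheory.EllipticCurves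
  Literature.NumberTheory.EllipticCurves.ModularForms

namespace Summit.BirchSwinnertonDyer.BirchSwinnertonDyer.Theorems.ThetaLayerLambdaCongruenceAtTwo

/-! ## §1. The `K_g`-valued plus symbol is even and `1`-periodic -/

section Symbols

variable {N : ℕ} (g : CuspForm (CongruenceSubgroup.Gamma0 N) 2) (Ω : ℂ)

/-- `plusSymbol g (r + k) = plusSymbol g r` for `k ∈ ℤ` (`{∞, r+k} = {∞, r}`, `modularSymbol_add_intCast_holds`,
applied at `r` and at `−r`). [cite: Manin1972, §1.2] -/
theorem plusSymbol_add_intCast [NeZero N] (r : ℚ) (k : ℤ) : plusSymbol g (r + k) = plusSymbol g r := by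
  have h1 := modularSymbol_add_intCast_holds g r k
  have h2 := modularSymbol_add_intCast_holds g (-r) (-k)
  have e : -(r + (k : ℚ)) = -r + ((-k : ℤ) : ℚ) := by push_cast; ring
  simp only [plusSymbol]
  rw [h1, e, h2]

/-- `[−r]⁺_{g,Ω} = [r]⁺_{g,Ω}` in `K_g` (the plus symbol is even by construction, `plusSymbol_neg`).
[cite: MazurTateTeitelbaum1986Invent, §I.8] -/
theorem plusSymbolK_neg (r : ℚ) : plusSymbolK g Ω (-r) = plusSymbolK g Ω r := by
  unfold plusSymbolK
  simp only [plusSymbol_neg]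

/-- `[r + k]⁺_{g,Ω} = [r]⁺_{g,Ω}` in `K_g` for `k ∈ ℤ`. [cite: Manin1972, §1.2] -/
theorem plusSymbolK_add_intCast [NeZero N] (r : ℚ) (k : ℤ) : plusSymbolK g Ω (r + k) = plusSymbolK g Ω r := by
  unfold plusSymbolK
  simp only [plusSymbol_add_intCast]

end Symbols

/-! ## §2. The `Δ = {±1}` doubling of `θ_n(g;Ω)` at `p = 2` -/

section Doubling

variable {N : ℕ} [NeZero N] (g : CuspForm (CongruenceSubgroup.Gamma0 N) 2) (Ω : ℂ)

/-- The `2`-adic roots of unity of order dividing `2` are `±1` (private helper; `ℤ₂` is a domain). [folklore] -/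
private theorem coe_rootsOfUnity_two_eq_or' (ξ : rootsOfUnity 2 ℤ_[2]) :
    ((ξ : ℤ_[2]ˣ) : ℤ_[2]) = 1 ∨ ((ξ : ℤ_[2]ˣ) : ℤ_[2]) = -1 := by
  have h := ξ.2
  rw [mem_rootsOfUnity] at h
  have h' : (((ξ : ℤ_[2]ˣ) : ℤ_[2])) ^ 2 = 1 := by
    rw [← Units.val_pow_eq_pow_val, h, Units.val_one]
  exact sq_eq_one_iff.mp h'

/-- The `ξ = −1` summand equals the `ξ = 1` summand: for `x = γ^s ∈ (ℤ/2^{n+2})ˣ`,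
`[(−x).val/2^{n+2}]⁺ = [1 − x.val/2^{n+2}]⁺ = [x.val/2^{n+2}]⁺` (periodicity and evenness). [cite: MazurTateTeitelbaum1986Invent, §I.8 and §I.13] -/
theorem plusSymbolK_neg_val_div (n : ℕ) (s : ℕ) :
    plusSymbolK g Ω (((-((cyclotomicGenerator 2 : ZMod (2 ^ (n + 2))) ^ s)).val : ℚ) / (2 : ℚ) ^ (n + 2)) =
      plusSymbolK g Ω ((((cyclotomicGenerator 2 : ZMod (2 ^ (n + 2))) ^ s).val : ℚ) / (2 : ℚ) ^ (n + 2)) := by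
  haveI : Fact (1 < 2 ^ (n + 2)) := ⟨Nat.one_lt_two_pow (by omega)⟩
  set x : ZMod (2 ^ (n + 2)) := (cyclotomicGenerator 2 : ZMod (2 ^ (n + 2))) ^ s with hx
  have hunit : IsUnit x := by
    rw [hx]
    refine IsUnit.pow _ ?_
    rw [ZMod.isUnit_iff_coprime, cyclotomicGenerator_two]
    exact Nat.Coprime.pow_right _ (by norm_num)
  have hx0 : x ≠ 0 := hunit.ne_zero
  have hval : (-x).val = 2 ^ (n + 2) - x.val := by rw [ZMod.neg_val, if_neg hx0]
  have hlt : x.val ≤ 2 ^ (n + 2) := (ZMod.val_lt x).le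
  have hcast : (((-x).val : ℕ) : ℚ) = (2 : ℚ) ^ (n + 2) - (x.val : ℚ) := by
    rw [hval, Nat.cast_sub hlt]; push_cast; ring
  have e : (((-x).val : ℕ) : ℚ) / (2 : ℚ) ^ (n + 2) = -((x.val : ℚ) / (2 : ℚ) ^ (n + 2)) + ((1 : ℤ) : ℚ) := by
    rw [hcast]; push_cast; field_simp; ring
  rw [e, plusSymbolK_add_intCast, plusSymbolK_neg]

/-- **The `Δ`-doubling at `p = 2`.** `θ_n(g;Ω) = mazurTateElementK g Ω 2 n = C 2 · ∑_{s mod 2ⁿ} [5^s/2^{n+2}]⁺_{g,Ω}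
(1+X)^s`: the torsion of `ℤ₂ˣ` is `{±1}` (`torsionOrder 2 = 2`, level `2^{n+2}`, `γ = cyclotomicGenerator 2 = 5`) and
the `ξ = −1` half of the defining double sum equals the `ξ = 1` half (`plusSymbolK_neg_val_div`) — the `K_g`-valued
twin of `padicLRiemannSum_two`. [cite: MazurTateTeitelbaum1986Invent, §I.13 (p = 2: Δ = {±1}, γ = 5)] -/
theorem mazurTateElementK_two (n : ℕ) :
    mazurTateElementK g Ω 2 n =
      C (2 : coeffField g) * ∑ s : ZMod (2 ^ n),
        C (plusSymbolK g Ω ((((cyclotomicGenerator 2 : ZMod (2 ^ (n + 2))) ^ s.val).val : ℚ) /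
          (2 : ℚ) ^ (n + 2))) * (X + 1) ^ s.val := by
  classical
  -- the summand as a function of the Teichmüller representative
  set G : ℤ_[2] → (coeffField g)[X] := fun u ↦ ∑ s : ZMod (2 ^ n),
    C (plusSymbolK g Ω (((PadicInt.toZModPow (n + 2) u *
        (cyclotomicGenerator 2 : ZMod (2 ^ (n + 2))) ^ s.val).val : ℚ) / (2 : ℚ) ^ (n + 2))) *
      (X + 1) ^ s.val with hG
  have hG1 : G 1 = ∑ s : ZMod (2 ^ n),
      C (plusSymbolK g Ω ((((cyclotomicGenerator 2 : ZMod (2 ^ (n + 2))) ^ s.val).val : ℚ) /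
        (2 : ℚ) ^ (n + 2))) * (X + 1) ^ s.val := by
    simp only [hG, map_one, one_mul]
  have hGneg : G (-1) = G 1 := by
    simp only [hG, map_neg, map_one, neg_one_mul, one_mul, plusSymbolK_neg_val_div]
  -- the torsion group at `2` is `{1, ζ}` with `ζ = -1`
  have hζmem : (-1 : ℤ_[2]ˣ) ∈ rootsOfUnity 2 ℤ_[2] := by
    rw [mem_rootsOfUnity]; norm_num
  set ζ : rootsOfUnity 2 ℤ_[2] := ⟨-1, hζmem⟩ with hζ
  have hne : (1 : rootsOfUnity 2 ℤ_[2]) ≠ ζ := by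
    intro h
    have h' : (((1 : rootsOfUnity 2 ℤ_[2]) : ℤ_[2]ˣ) : ℤ_[2]) = ((ζ : ℤ_[2]ˣ) : ℤ_[2]) := by
      rw [h]
    rw [hζ] at h'
    simp only [OneMemClass.coe_one, Units.val_one, Units.val_neg] at h'
    have h2 : (2 : ℤ_[2]) = 0 := by linear_combination h'
    exact two_ne_zero h2
  haveI : Fintype (rootsOfUnity 2 ℤ_[2]) := Fintype.ofFinite _
  have huniv : (Finset.univ : Finset (rootsOfUnity 2 ℤ_[2])) = {1, ζ} := by
    ext ξ
    simp only [Finset.mem_univ, Finset.mem_insert, Finset.mem_singleton, true_iff]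
    rcases coe_rootsOfUnity_two_eq_or' ξ with h | h
    · left
      exact Subtype.ext (Units.ext (by simpa using h))
    · right
      exact Subtype.ext (Units.ext (by rw [hζ]; simpa using h))
  -- unfold the Mazur–Tate element at `p = 2`
  have hRS : mazurTateElementK g Ω 2 n =
      ∑ᶠ ξ : rootsOfUnity (torsionOrder 2) ℤ_[2], G ((ξ : ℤ_[2]ˣ) : ℤ_[2]) := by
    rw [mazurTateElementK]
    rfl
  rw [hRS, torsionOrder_two, finsum_eq_sum_of_fintype, huniv, Finset.sum_pair hne]
  simp only [OneMemClass.coe_one, Units.val_one, hζ, Units.val_neg]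
  rw [hGneg, hG1, ← two_mul, ← map_ofNat C 2]

end Doubling

/-! ## §3. At a cohomological period: `‖θ_n(g;Ω)‖_sup ≤ ‖2‖ = 1/2` for every `n` -/

section Cohomological

variable {N : ℕ} [NeZero N] {g : CuspForm (CongruenceSubgroup.Gamma0 N) 2}
  {ι : coeffField g →+* PadicAlgCl 2} {Ω : ℂ}

/-- `‖2‖₂ = 1/2 < 1` in `ℚ̄₂` (the value `‖(2 : PadicAlgCl 2)‖ = 2⁻¹` is the landed
`…Theorems.ResidualThetaLayer.norm_two_padicAlgCl`; only the strict bound is needed here). [folklore] -/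
theorem norm_two_padicAlgCl_lt_one : ‖(2 : PadicAlgCl 2)‖ < 1 := by
  have h : ‖(2 : PadicAlgCl 2)‖ = (2 : ℝ)⁻¹ := by
    rw [show (2 : PadicAlgCl 2) = ((2 : ℕ) : PadicAlgCl 2) by norm_num,
      ← map_natCast (algebraMap ℚ_[2] (PadicAlgCl 2)) 2]
    change ‖(((2 : ℕ) : ℚ_[2]) : PadicAlgCl 2)‖ = (2 : ℝ)⁻¹
    rw [PadicAlgCl.norm_extends, Padic.norm_p]
    norm_num
  rw [h]; norm_num

/-- The norm of a natural number in `ℚ̄_p` is at most `1` (private helper). [folklore] -/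
private theorem norm_natCast_le_one' {p : ℕ} [Fact p.Prime] (m : ℕ) : ‖(m : PadicAlgCl p)‖ ≤ 1 :=
  Literature.NumberTheory.LFunctions.PadicRootsOfUnity.norm_natCast_le_one m

/-- **At a cohomological period every coefficient of `(θ_n(g;Ω)).map ι` has norm `≤ ‖2‖₂ = 1/2`** (`p = 2`): by the
doubling, the `j`-th coefficient is `2 · ∑_s ι[5^s/2^{n+2}]⁺ · (s choose j)`, a sum of `ι`-integral terms (PW Def. 2.1)
times `2`. [cite: PollackWeston2011MT, Def. 2.1 and Rem. 2.2] -/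
theorem norm_coeff_map_mazurTateElementK_two_le (h : IsCohomologicalPlusPeriod g ι Ω)
    (n j : ℕ) : ‖((mazurTateElementK g Ω 2 n).map ι).coeff j‖ ≤ ‖(2 : PadicAlgCl 2)‖ := by
  classical
  rw [mazurTateElementK_two, Polynomial.map_mul, Polynomial.map_C, map_ofNat, coeff_C_mul, norm_mul]
  refine mul_le_of_le_one_right (norm_nonneg _) ?_
  rw [Polynomial.map_sum, finsetSum_coeff]
  refine IsUltrametricDist.norm_sum_le_of_forall_le_of_nonneg zero_le_one fun s _ ↦ ?_
  rw [Polynomial.map_mul, Polynomial.map_C, Polynomial.map_pow, Polynomial.map_add, Polynomial.map_X,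
    Polynomial.map_one, coeff_C_mul, coeff_X_add_one_pow, norm_mul]
  exact mul_le_one₀ (h.norm_le_one _) (norm_nonneg _) (norm_natCast_le_one' _)

/-- **`‖(θ_n(g;Ω)).map ι‖_sup ≤ ‖2‖₂`** at a cohomological period, for every `n` (`p = 2`).
[cite: PollackWeston2011MT, Rem. 2.2] -/
theorem supNorm_map_mazurTateElementK_two_le (h : IsCohomologicalPlusPeriod g ι Ω)
    (n : ℕ) : ((mazurTateElementK g Ω 2 n).map ι).supNorm ≤ ‖(2 : PadicAlgCl 2)‖ := by
  obtain ⟨j, hj⟩ := ((mazurTateElementK g Ω 2 n).map ι).exists_eq_supNorm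
  rw [hj]
  exact norm_coeff_map_mazurTateElementK_two_le h n j

/-- Hence `‖(θ_n(g;Ω)).map ι‖_sup ≤ 1/2 < 1`: in the tree's normalisation at `2` the layer element of a cohomological
period NEVER has a unit coefficient. [cite: PollackWeston2011MT, Rem. 2.2] -/
theorem supNorm_map_mazurTateElementK_two_lt_one (h : IsCohomologicalPlusPeriod g ι Ω)
    (n : ℕ) : ((mazurTateElementK g Ω 2 n).map ι).supNorm < 1 :=
  (supNorm_map_mazurTateElementK_two_le h n).trans_lt norm_two_padicAlgCl_lt_one

end Cohomological

/-! ## §4. The partner's depletion Euler factors are integral; `‖Θ^{S₀}_n(g;Ω)‖_sup ≤ 1/2` -/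

section Euler

variable {K : Type*} [NormedField K] [IsUltrametricDist K]

omit [IsUltrametricDist K] in
/-- `‖P‖_sup ≤ c` as soon as every coefficient has norm `≤ c`. [folklore] -/
theorem supNorm_le_of_forall_coeff_le {P : K[X]} {c : ℝ} (h : ∀ j, ‖P.coeff j‖ ≤ c) : P.supNorm ≤ c := by
  obtain ⟨j, hj⟩ := P.exists_eq_supNorm
  rw [hj]; exact h j

/-- `‖P^k‖_sup = ‖P‖_sup^k` over an ultrametric normed field (Gauss). [cite: Washington1997, §7.1] -/
theorem supNorm_pow' (P : K[X]) (k : ℕ) : (P ^ k).supNorm = P.supNorm ^ k := by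
  induction k with
  | zero => rw [pow_zero, pow_zero, ← C_1, supNorm_C, norm_one]
  | succ k ih => rw [pow_succ, supNorm_mul', ih, pow_succ]

/-- A finite product of polynomials of sup norm `≤ 1` has sup norm `≤ 1`. [folklore] -/
theorem supNorm_prod_le_one {α : Type*} (s : Finset α) (F : α → K[X]) (h : ∀ i ∈ s, (F i).supNorm ≤ 1) :
    (∏ i ∈ s, F i).supNorm ≤ 1 := by
  classical
  induction s using Finset.induction_on with
  | empty => rw [Finset.prod_empty, ← C_1, supNorm_C, norm_one]
  | insert a s ha ih =>
    rw [Finset.prod_insert ha, supNorm_mul']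
    exact mul_le_one₀ (h a (Finset.mem_insert_self a s)) (supNorm_nonneg _)
      (ih fun i hi ↦ h i (Finset.mem_insert_of_mem hi))

/-- Composition of integral polynomials is integral: `‖P‖_sup ≤ 1`, `‖Q‖_sup ≤ 1 ⟹ ‖P ∘ Q‖_sup ≤ 1`. [folklore] -/
theorem supNorm_comp_le_one {P Q : K[X]} (hP : P.supNorm ≤ 1) (hQ : Q.supNorm ≤ 1) : (P.comp Q).supNorm ≤ 1 := by
  rw [comp_eq_sum_left, Polynomial.sum_def]
  refine supNorm_le_of_forall_coeff_le fun j ↦ ?_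
  rw [finsetSum_coeff]
  refine IsUltrametricDist.norm_sum_le_of_forall_le_of_nonneg zero_le_one fun i _ ↦ ?_
  rw [coeff_C_mul, norm_mul]
  refine mul_le_one₀ ((P.le_supNorm i).trans hP) (norm_nonneg _) (((Q ^ i).le_supNorm j).trans ?_)
  rw [supNorm_pow']
  exact pow_le_one₀ (supNorm_nonneg Q) hQ

/-- Algebraic integers of `ℚ̄_p` have norm at most one (the valuation ring of `ℚ̄_p` is integrally closed). [folklore] -/
private theorem norm_le_one_of_isIntegral' {p : ℕ} [Fact p.Prime] {x : PadicAlgCl p} (hx : IsIntegral ℤ x) :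
    ‖x‖ ≤ 1 := by
  have hv := Valuation.integer.integers (Valued.v (R := PadicAlgCl p))
  have hx' : IsIntegral (Valued.v (R := PadicAlgCl p)).integer x := hx.tower_top
  have h := (hv.isIntegral_iff_v_le_one).mp hx'
  rw [PadicAlgCl.valuation_def] at h
  exact_mod_cast h

variable {N : ℕ} [NeZero N] {g : CuspForm (CongruenceSubgroup.Gamma0 N) 2}

/-- **`ι(a_m(g))` is `p`-integral for a newform `g`**: the Fourier coefficients of a newform on `Γ₀(N)` are algebraic
integers (Shimura 1971 Thm. 3.48(3), tree theorem `IsNewform0.isIntegral_coeff_holds`), and algebraic integers of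
`ℚ̄_p` have norm `≤ 1`. [cite: Shimura1971, Thm. 3.48(3), p. 83] -/
theorem norm_embCoeff_le_one (hg : IsNewform0 g) {p : ℕ} [Fact p.Prime] (ι : coeffField g →+* PadicAlgCl p)
    (m : ℕ) : ‖embCoeff g ι m‖ ≤ 1 := by
  rw [embCoeff_def]
  apply norm_le_one_of_isIntegral'
  have hint : IsIntegral ℤ (cuspCoeff g m) := IsNewform0.isIntegral_coeff_holds hg m
  have hK : IsIntegral ℤ (⟨cuspCoeff g m, coeff_mem_coeffField g m⟩ : coeffField g) := by
    exact (isIntegral_algHom_iff ((algebraMap (coeffField g) ℂ).toIntAlgHom) Subtype.val_injective).mp hint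
  exact hK.map (ι : coeffField g →+* PadicAlgCl p).toIntAlgHom

/-- An odd natural number is a `2`-adic unit: `‖ℓ‖₂ = 1` in `ℚ̄₂`. [folklore] -/
theorem norm_natCast_padicAlgCl_two_eq_one {ℓ : ℕ} (hℓ : ¬ 2 ∣ ℓ) : ‖(ℓ : PadicAlgCl 2)‖ = 1 := by
  rw [← map_natCast (algebraMap ℚ_[2] (PadicAlgCl 2)) ℓ]
  change ‖((ℓ : ℚ_[2]) : PadicAlgCl 2)‖ = 1
  rw [PadicAlgCl.norm_extends, Padic.norm_natCast_eq_one_iff]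
  exact (Nat.Prime.coprime_iff_not_dvd Nat.prime_two).mpr hℓ

/-- For `v ∈ S₀` with `2 ∉ v`, the prime `ℓ_v = natGenerator v` is odd. [folklore] -/
theorem not_two_dvd_natGenerator {v : IsDedekindDomain.HeightOneSpectrum (NumberField.RingOfIntegers ℚ)}
    (hv : ((2 : ℕ) : NumberField.RingOfIntegers ℚ) ∉ v.asIdeal) : ¬ 2 ∣ Rat.HeightOneSpectrum.natGenerator v := by
  intro h
  have hp := Rat.HeightOneSpectrum.prime_natGenerator v
  have h2 : Rat.HeightOneSpectrum.natGenerator v = 2 :=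
    ((Nat.prime_dvd_prime_iff_eq Nat.prime_two hp).mp h).symm
  have hmem := (Rat.HeightOneSpectrum.natGenerator_dvd_iff v (n := 2)).mp (by rw [h2])
  rw [← map_natCast (Rat.IsIntegralClosure.intEquiv (NumberField.RingOfIntegers ℚ)) 2,
    Ideal.apply_mem_of_equiv_iff] at hmem
  exact hv hmem

/-- **The partner's depletion Euler factor at `v ∈ S₀` is `ι`-integral**: for a newform `g` and an odd prime `ℓ`,
`‖(1 − ι a_ℓ(g)·X + 𝟙_{ℓ∤M} ℓ·X²) ∘ (ℓ⁻¹(X+1)^e)‖_sup ≤ 1` (`‖ι a_ℓ‖ ≤ 1`, `‖ℓ⁻¹‖₂ = 1`, binomial coefficients are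
integers). [cite: GreenbergVatsal2000, §1 (the non-primitive Euler factors; integrality)] -/
theorem supNorm_partnerEulerFactor_le_one (hg : IsNewform0 g) (ι : coeffField g →+* PadicAlgCl 2) (M : ℕ) {ℓ : ℕ}
    (hℓ : ¬ 2 ∣ ℓ) (e : ℕ) :
    ((1 - C (embCoeff g ι ℓ) * X + (if ℓ ∣ M then 0 else C (ℓ : PadicAlgCl 2)) * X ^ 2).comp
      (C ((ℓ : PadicAlgCl 2)⁻¹) * (X + 1) ^ e)).supNorm ≤ 1 := by
  have hX1 : ((X + 1 : (PadicAlgCl 2)[X])).supNorm ≤ 1 :=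
    (supNorm_add_le_max _ _).trans (max_le (by rw [supNorm_X]) (by rw [← C_1, supNorm_C, norm_one]))
  apply supNorm_comp_le_one
  · -- the quadratic Euler polynomial is integral
    refine (supNorm_add_le_max _ _).trans (max_le ((supNorm_sub_le_max _ _).trans (max_le ?_ ?_)) ?_)
    · rw [← C_1, supNorm_C, norm_one]
    · rw [supNorm_C_mul, supNorm_X, mul_one]; exact norm_embCoeff_le_one hg ι ℓ
    · split_ifs
      · rw [zero_mul, supNorm_zero]; exact zero_le_one
      · rw [supNorm_C_mul, supNorm_pow', supNorm_X, one_pow, mul_one]; exact norm_natCast_le_one' ℓ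
  · rw [supNorm_C_mul, norm_inv, norm_natCast_padicAlgCl_two_eq_one hℓ, inv_one, one_mul, supNorm_pow']
    exact pow_le_one₀ (supNorm_nonneg _) hX1

/-- **`‖Θ^{S₀}_n(g;Ω)‖_sup ≤ ‖2‖₂ = 1/2` at a cohomological period**, for a newform `g`, every `S₀` off `2` and every
layer `n`: the partner's depleted layer element of the crux is `(θ_n(g;Ω)^ι · ∏_{v∈S₀} P_{g,v}) %ₘ ω_n` with
`‖θ_n(g;Ω)^ι‖_sup ≤ 1/2` (§3), integral Euler factors (§4) and a sup-norm non-increasing reduction modulo the integral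
monic `ω_n = (X+1)^{2ⁿ} − 1` (landed `supNorm_modByMonic_le`). [cite: PollackWeston2011MT, Rem. 2.2] -/
theorem supNorm_depletedPartnerLayer_le (hg : IsNewform0 g) {ι : coeffField g →+* PadicAlgCl 2} {Ω : ℂ}
    (h : IsCohomologicalPlusPeriod g ι Ω) (M : ℕ)
    (S₀ : Finset (IsDedekindDomain.HeightOneSpectrum (NumberField.RingOfIntegers ℚ)))
    (hS2 : ∀ v ∈ S₀, ((2 : ℕ) : NumberField.RingOfIntegers ℚ) ∉ v.asIdeal) (n : ℕ) :
    (((mazurTateElementK g Ω 2 n).map ι * ∏ v ∈ S₀, (1 - C (embCoeff g ι (Rat.HeightOneSpectrum.natGenerator v)) * X + (if Rat.HeightOneSpectrum.natGenerator v ∣ M then 0 else C (Rat.HeightOneSpectrum.natGenerator v : PadicAlgCl 2)) * X ^ 2).comp (C ((Rat.HeightOneSpectrum.natGenerator v : PadicAlgCl 2)⁻¹) * (X + 1) ^ (PadicInt.toZModPow n (-(GreenbergVatsal2000.frobeniusExponent 2 (Rat.HeightOneSpectrum.natGenerator v : ℤ_[2])))).val)) %ₘ ((X + 1) ^ 2 ^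 n - 1)).supNorm ≤ ‖(2 : PadicAlgCl 2)‖ := by
  refine (supNorm_modByMonic_le (monic_layerModulus (p := 2) n) (supNorm_layerModulus_le_one (p := 2) n) _).trans ?_
  rw [supNorm_mul']
  refine (mul_le_of_le_one_right (supNorm_nonneg _) ?_).trans (supNorm_map_mazurTateElementK_two_le h n)
  exact supNorm_prod_le_one _ _ fun v hv ↦
    supNorm_partnerEulerFactor_le_one hg ι M (not_two_dvd_natGenerator (hS2 v hv)) _

/-- Hence `‖Θ^{S₀}_n(g;Ω)‖_sup < 1`, in particular `≠ 1`, at EVERY layer `n`. [cite: PollackWeston2011MT, Rem. 2.2] -/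
theorem supNorm_depletedPartnerLayer_lt_one (hg : IsNewform0 g) {ι : coeffField g →+* PadicAlgCl 2} {Ω : ℂ}
    (h : IsCohomologicalPlusPeriod g ι Ω) (M : ℕ)
    (S₀ : Finset (IsDedekindDomain.HeightOneSpectrum (NumberField.RingOfIntegers ℚ)))
    (hS2 : ∀ v ∈ S₀, ((2 : ℕ) : NumberField.RingOfIntegers ℚ) ∉ v.asIdeal) (n : ℕ) :
    (((mazurTateElementK g Ω 2 n).map ι * ∏ v ∈ S₀, (1 - C (embCoeff g ι (Rat.HeightOneSpectrum.natGenerator v)) * X + (if Rat.HeightOneSpectrum.natGenerator v ∣ M then 0 else C (Rat.HeightOneSpectrum.natGenerator v : PadicAlgCl 2)) * X ^ 2).comp (C ((Rat.HeightOneSpectrum.natGenerator v : PadicAlgCl 2)⁻¹) * (X + 1) ^ (PadicInt.toZModPow n (-(GreenbergVatsal2000.frobeniusExponent 2 (Rat.HeightOneSpectrum.natGenerator v : ℤ_[2])))).val)) %ₘ ((X + 1) ^ 2 ^ n - 1)).supNorm < 1 :=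
  (supNorm_depletedPartnerLayer_le hg h M S₀ hS2 n).trans_lt norm_two_padicAlgCl_lt_one

end Euler

/-! ## §5. Consequences for the registered stubs (μ) and (H) of skeleton v3 -/

/-- **The conclusion of the registered stub (μ) `stub_depletedLayerMuCoh` (skeleton v3 of line `birth`, sha16
e73fe75e5ab62447) is FALSE for every instance of its binders.** For any newform `g` on `Γ₀(M)`, any `ι`, any
COHOMOLOGICAL plus period `Ω` and any `S₀` off `2`, it is NOT the case that `‖Θ^{S₀}_n(g;Ω)‖_sup = 1` for all large
even `n` — because `‖Θ^{S₀}_n(g;Ω)‖_sup ≤ 1/2` at every `n` (§4; the `Δ = {±1}` doubling). So (μ) as registered is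
mis-stated (it holds only if the habitat⁺ × partner data is empty); the faithful «`μ = 0` of the partner's depleted
layer element» reads `‖Θ^{S₀}_n(g;Ω)‖_sup = ‖2‖₂` in the tree's normalisation. [cite: PollackWeston2011MT, Rem. 2.2 and §3.1] -/
theorem not_stubMu_conclusion {M : ℕ} [NeZero M] {g : CuspForm (CongruenceSubgroup.Gamma0 M) 2} (hg : IsNewform0 g)
    {ι : coeffField g →+* PadicAlgCl 2} {Ω : ℂ} (h : IsCohomologicalPlusPeriod g ι Ω)
    (S₀ : Finset (IsDedekindDomain.HeightOneSpectrum (NumberField.RingOfIntegers ℚ)))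
    (hS2 : ∀ v ∈ S₀, ((2 : ℕ) : NumberField.RingOfIntegers ℚ) ∉ v.asIdeal) :
    ¬ ∃ n₀ : ℕ, ∀ n ≥ n₀, Even n → (((mazurTateElementK g Ω 2 n).map ι * ∏ v ∈ S₀, (1 - C (embCoeff g ι (Rat.HeightOneSpectrum.natGenerator v)) * X + (if Rat.HeightOneSpectrum.natGenerator v ∣ M then 0 else C (Rat.HeightOneSpectrum.natGenerator v : PadicAlgCl 2)) * X ^ 2).comp (C ((Rat.HeightOneSpectrum.natGenerator v : PadicAlgCl 2)⁻¹) * (X + 1) ^ (PadicInt.toZModPow n (-(GreenbergVatsal2000.frobeniusExponent 2 (Rat.HeightOneSpectrum.natGenerator v : ℤ_[2])))).val)) %ₘ ((X + 1) ^ 2 ^ n - 1)).supNorm = 1 := by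
  rintro ⟨n₀, hn₀⟩
  have h1 := hn₀ (2 * n₀) (by omega) (even_two_mul n₀)
  exact (supNorm_depletedPartnerLayer_lt_one hg h M S₀ hS2 (2 * n₀)).ne h1

/-- **The conclusion of the registered stub (H) `stub_depletedLayerCongruenceCoh` holds TRIVIALLY** at a cohomological
period: with `a = 0`, `‖C 0·Θ_W − Θ^{S₀}_n(g;Ω)‖_sup = ‖Θ^{S₀}_n(g;Ω)‖_sup ≤ 1/2 < 1` for EVERY `n` and every `W`-side
element `Θ_W` — so (H) as registered carries no information; the faithful integral congruence reads
`‖C a·Θ_W − Θ_g‖_sup < ‖2‖₂`, and the scale-free form is `‖C a·Θ_W − Θ_g‖_sup < ‖Θ_g‖_sup` (companion glue file).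
[cite: PollackWeston2011MT, Rem. 2.2] -/
theorem stubH_conclusion_trivial {M : ℕ} [NeZero M] {g : CuspForm (CongruenceSubgroup.Gamma0 M) 2}
    (hg : IsNewform0 g) {ι : coeffField g →+* PadicAlgCl 2} {Ω : ℂ} (h : IsCohomologicalPlusPeriod g ι Ω)
    (S₀ : Finset (IsDedekindDomain.HeightOneSpectrum (NumberField.RingOfIntegers ℚ)))
    (hS2 : ∀ v ∈ S₀, ((2 : ℕ) : NumberField.RingOfIntegers ℚ) ∉ v.asIdeal) (ΘW : ℕ → (PadicAlgCl 2)[X]) :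
    ∃ n₀ : ℕ, ∀ n ≥ n₀, Even n → ∃ a : PadicAlgCl 2, (C a * ΘW n - (((mazurTateElementK g Ω 2 n).map ι * ∏ v ∈ S₀, (1 - C (embCoeff g ι (Rat.HeightOneSpectrum.natGenerator v)) * X + (if Rat.HeightOneSpectrum.natGenerator v ∣ M then 0 else C (Rat.HeightOneSpectrum.natGenerator v : PadicAlgCl 2)) * X ^ 2).comp (C ((Rat.HeightOneSpectrum.natGenerator v : PadicAlgCl 2)⁻¹) * (X + 1) ^ (PadicInt.toZModPow n (-(GreenbergVatsal2000.frobeniusExponent 2 (Rat.HeightOneSpectrum.natGenerator v : ℤ_[2])))).val)) %ₘ ((X + 1) ^ 2 ^ n - 1))).supNorm < 1 := by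
  refine ⟨0, fun n _ _ ↦ ⟨0, ?_⟩⟩
  rw [map_zero, zero_mul, zero_sub, neg_eq_neg_one_mul, ← C_1, ← C_neg, supNorm_C_mul, norm_neg, norm_one,
    one_mul]
  exact supNorm_depletedPartnerLayer_lt_one hg h M S₀ hS2 n

end Summit.BirchSwinnertonDyer.BirchSwinnertonDyer.Theorems.ThetaLayerLambdaCongruenceAtTwo

end
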